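import Mathlib
import Literature.Analysis.Calculus.RayTaylor
import HarnessLib

/-!
# Parametric Taylor remainders in value-flat (`IsBigO`) form, one and two variables

Topic `Analysis/Calculus`; namespace `Literature.Analysis.Calculus`.  THEOREMS ONLY (no `def`, no instance, no notation, no named
fact, no `sorry`); Mathlib + ★ `RayTaylor` only.  Generic calculus brick of the GLAESER–CHEVALLEY `S₃` road G″ (cell
`pub/hodgecm-mathlib`, N8-census §5 (9), LEAD T13-42 priority (5); binder LH7-p01 (g6); this file = the B2-independent half «FILE A»
of brick B2′, F0P2-p02 (g20)): the VALUE-FLAT currency in which brick B1 («formal part at the corner») states and consumes Taylor data.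

THE MATHEMATICS.  `F : ℝ × Y → E` smooth (`Y`, `E` real normed spaces), VARIABLE FIRST, parameter last.
* §1 (A2) **slice jets are jointly smooth**: `(s, y) ↦ ∂ₛʲ F(s, y)` is `C^∞` on `ℝ × Y`, and so is the section `y ↦ ∂ₛʲ F(0, y)`
  (`contDiff_iteratedDeriv_slice_fst`, `…_zero`; the `E`-valued twin of ★ `NestedJets.contDiff_iteratedDeriv_snd`, by Mathlib's
  `ContDiff.fderiv_apply` and induction on `j`).
* §2 (A1) **one variable with parameters**: for every `y₀` and `N`,
  `F(s, y) − Σ_{j ≤ N} (sʲ / j!) • ∂ₛʲ F(0, y) = O(|s|^{N+1})` as `(s, y) → (0, y₀)`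
  (`isBigO_sub_taylorSum_fst`): ★ `RayTaylor.norm_sub_raySum_le` for the slice `s ↦ F(s, y)` on the segment `[−|s|, |s|]`, with the
  `(N+1)`-st slice jet bounded near `(0, y₀)` by the continuity of §1 — so the constant is UNIFORM in the parameter.
* §3 (A3) **two variables with parameters**: for `G : ℝ × ℝ × P → E` smooth, `z₀ : P`, `N : ℕ`,
  `G(u, v, z) − Σ_{i ≤ N} Σ_{j ≤ N} (uⁱ vʲ / (i! j!)) • ∂ᵤⁱ ∂ᵥʲ G(0, 0, z) = O(‖(u, v)‖^{N+1})` as `(u, v, z) → (0, 0, z₀)`, where the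
  coefficient is the NESTED jet `iteratedDeriv i (fun u ↦ iteratedDeriv j (fun v ↦ G (u, v, z)) 0) 0` (★ `NestedJets` shape):
  §2 in `v` with parameter `(u, z)`, then §2 in `u` with parameter `z` for each of the `N + 1` smooth (§1) coefficient functions
  `(u, z) ↦ ∂ᵥʲ G(u, 0, z)`, the bounded weights `vʲ / j!`, and `|u|, |v| ≤ ‖(u, v)‖` (`isBigO_sub_taylorSum₂`).  Square truncation
  `i, j ≤ N`; no multilinear (`iteratedFDeriv`) bookkeeping is needed by a consumer.
HONEST LABEL: count-neutral Mathlib-side analysis; HC_CM is proved only modulo the printed citations (hLiu418 = `stmt-HodgeConjecture-24832`,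
h413 = `stmt-HodgeConjecture-24833`) until rung 0 closes.

## References
* [HormanderALPDO1] L. Hörmander, *The Analysis of Linear Partial Differential Operators I*, Grundlehren 256 (1983; Classics ed.
  2003, same numbering), §1.1: Thm. 1.1.6 (characterisation of `C^k` by continuous partial derivatives), Thm. 1.1.8 (symmetry), Taylor's
  formula (1.1.7)–(1.1.7)′ with the remainder estimate (1.1.8), pp. 11–13.  The statements here are the parameter-uniform `O`-forms of
  (1.1.7)–(1.1.8) (one and two real variables, Banach-valued, coefficients smooth in the parameter by Thm. 1.1.6).
-/

noncomputable section

open Set Filter Topology Asymptotics Finset Metric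
open scoped ContDiff Nat

namespace Literature.Analysis.Calculus

/-- `∞ + 1 ≤ ∞` in `WithTop ℕ∞` (definitional). [folklore] -/
private theorem infty_add_one_le' : (∞ : WithTop ℕ∞) + 1 ≤ ∞ := le_rfl

section OneVar

variable {Y : Type*} [NormedAddCommGroup Y] [NormedSpace ℝ Y]
  {E : Type*} [NormedAddCommGroup E] [NormedSpace ℝ E]

/-! ## §1 Slice jets in the first variable are jointly smooth -/

/-- For `F : ℝ × Y → E` jointly smooth, the partial derivative in the first (real) variable, `(s, y) ↦ ∂ₛ F(s, y)`, is jointly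
smooth (Mathlib's `ContDiff.fderiv_apply`). [cite: HormanderALPDO1, §1.1 Thm. 1.1.6 and the paragraph after (1.1.8), pp. 11–13] -/
theorem contDiff_deriv_slice_fst {F : ℝ × Y → E} (hF : ContDiff ℝ ∞ F) :
    ContDiff ℝ ∞ (fun q : ℝ × Y => deriv (fun s => F (s, q.2)) q.1) := by
  have hf : ContDiff ℝ ∞ (Function.uncurry fun (q : ℝ × Y) (s : ℝ) => F (s, q.2)) :=
    hF.comp (contDiff_snd.prodMk (contDiff_snd.comp contDiff_fst))
  exact ContDiff.fderiv_apply (f := fun (q : ℝ × Y) (s : ℝ) => F (s, q.2)) (g := fun q => q.1)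
    (k := fun _ => (1 : ℝ)) hf contDiff_fst contDiff_const infty_add_one_le'

/-- (A2) For `F : ℝ × Y → E` jointly smooth, every slice jet `(s, y) ↦ ∂ₛʲ F(s, y)` is jointly smooth (induction on `j`). [cite: HormanderALPDO1, §1.1 Thm. 1.1.6 and the paragraph after (1.1.8), pp. 11–13] -/
theorem contDiff_iteratedDeriv_slice_fst {F : ℝ × Y → E} (hF : ContDiff ℝ ∞ F) :
    ∀ j : ℕ, ContDiff ℝ ∞ (fun q : ℝ × Y => iteratedDeriv j (fun s => F (s, q.2)) q.1)
  | 0 => by simpa only [iteratedDeriv_zero] using hF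
  | j + 1 => by
    have h := contDiff_deriv_slice_fst (contDiff_iteratedDeriv_slice_fst hF j)
    simpa only [iteratedDeriv_succ] using h

/-- (A2, section form) … in particular the jets ALONG THE SECTION `s = 0`, `y ↦ ∂ₛʲ F(0, y)`, are smooth in the parameter. [cite: HormanderALPDO1, §1.1 Thm. 1.1.6 and the paragraph after (1.1.8), pp. 11–13] -/
theorem contDiff_iteratedDeriv_slice_fst_zero {F : ℝ × Y → E} (hF : ContDiff ℝ ∞ F) (j : ℕ) :
    ContDiff ℝ ∞ (fun y : Y => iteratedDeriv j (fun s => F (s, y)) 0) :=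
  (contDiff_iteratedDeriv_slice_fst hF j).comp (contDiff_const.prodMk contDiff_id)

/-! ## §2 One variable with parameters -/

/-- The ray jets of a one-variable function: `(j!)⁻¹ • (d/dt)ʲ g(t s)|₀ = (sʲ / j!) • g⁽ʲ⁾(0)`. [folklore] -/
private theorem inv_factorial_smul_iteratedDeriv_rayFun {g : ℝ → E} {N : ℕ}
    (hg : ContDiff ℝ ((N + 1 : ℕ) : WithTop ℕ∞) g) (s : ℝ) {j : ℕ} (hj : j ≤ N) :
    ((j ! : ℝ)⁻¹) • iteratedDeriv j (rayFun g s) 0 = (s ^ j / (j ! : ℝ)) • iteratedDeriv j g 0 := by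
  have h1 : rayFun g s = rayFun g (s • (1 : ℝ)) := by rw [smul_eq_mul, mul_one]
  have h2 : rayFun g 1 = g := by
    funext t
    simp [rayFun_apply]
  rw [h1, iteratedDeriv_rayFun_smul_zero hg 1 (natCast_le_succ_of_le hj) s, h2, smul_smul, div_eq_inv_mul]

/-- (A1) **Parametric Taylor remainder, value-flat form.**  For `F : ℝ × Y → E` smooth, `y₀ : Y` and `N : ℕ`:
`F(s, y) − Σ_{j ≤ N} (sʲ / j!) • ∂ₛʲ F(0, y) = O(|s|^{N+1})` as `(s, y) → (0, y₀)` — the constant is uniform in the parameter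
because the `(N+1)`-st slice jet is continuous, hence bounded near `(0, y₀)`. [cite: HormanderALPDO1, §1.1 Taylor's formula (1.1.7)–(1.1.7)′ and (1.1.8), pp. 12–13] -/
theorem isBigO_sub_taylorSum_fst (F : ℝ × Y → E) (hF : ContDiff ℝ ∞ F) (y₀ : Y) (N : ℕ) :
    (fun q : ℝ × Y => F q - ∑ j ∈ Finset.range (N + 1),
        (q.1 ^ j / (j ! : ℝ)) • iteratedDeriv j (fun s => F (s, q.2)) 0)
      =O[𝓝 ((0 : ℝ), y₀)] fun q => |q.1| ^ (N + 1) := by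
  -- the slice jet of order `N + 1` is continuous, hence `≤ K` on a ball about `(0, y₀)`
  have hJc : Continuous (fun q : ℝ × Y => iteratedDeriv (N + 1) (fun s => F (s, q.2)) q.1) :=
    (contDiff_iteratedDeriv_slice_fst hF (N + 1)).continuous
  set K : ℝ := ‖iteratedDeriv (N + 1) (fun s => F (s, y₀)) 0‖ + 1 with hK
  have hev : ∀ᶠ q in 𝓝 ((0 : ℝ), y₀), ‖iteratedDeriv (N + 1) (fun s => F (s, q.2)) q.1‖ ≤ K := by
    have ht := (Metric.tendsto_nhds.mp (hJc.tendsto ((0 : ℝ), y₀))) 1 one_pos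
    filter_upwards [ht] with q hq
    rw [dist_eq_norm] at hq
    have := norm_le_norm_add_norm_sub' (iteratedDeriv (N + 1) (fun s => F (s, q.2)) q.1)
      (iteratedDeriv (N + 1) (fun s => F (s, y₀)) 0)
    linarith
  obtain ⟨r, hr, hball⟩ := Metric.eventually_nhds_iff_ball.mp hev
  refine IsBigO.of_bound (K / N !) ?_
  filter_upwards [Metric.ball_mem_nhds ((0 : ℝ), y₀) hr] with q hq
  obtain ⟨s, y⟩ := q
  -- Taylor along the ray `t ↦ F (t s, y)` with the uniform bound `K`
  have hg : ContDiff ℝ ((N + 1 : ℕ) : WithTop ℕ∞) (fun t : ℝ => F (t, y)) :=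
    (hF.comp (contDiff_id.prodMk contDiff_const)).of_le (by exact_mod_cast le_top)
  have hKball : ∀ x ∈ closedBall (0 : ℝ) ‖s‖,
      ‖iteratedFDeriv ℝ (N + 1) (fun t : ℝ => F (t, y)) x‖ ≤ K := by
    intro x hx
    rw [norm_iteratedFDeriv_eq_norm_iteratedDeriv]
    have hxq : (x, y) ∈ Metric.ball ((0 : ℝ), y₀) r := by
      rw [Metric.mem_ball, Prod.dist_eq] at hq ⊢
      rw [mem_closedBall, dist_zero_right] at hx
      refine max_lt (lt_of_le_of_lt ?_ (lt_of_le_of_lt (le_max_left _ _) hq))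
        (lt_of_le_of_lt (le_max_right _ _) hq)
      simpa [dist_zero_right] using hx
    exact hball _ hxq
  have hray := norm_sub_raySum_le hg hKball (le_refl ‖s‖)
  rw [Finset.sum_congr rfl fun j hj =>
    inv_factorial_smul_iteratedDeriv_rayFun hg s (Finset.mem_range_succ_iff.mp hj)] at hray
  calc ‖F (s, y) - ∑ j ∈ Finset.range (N + 1), (s ^ j / (j ! : ℝ)) • iteratedDeriv j (fun t => F (t, y)) 0‖
      ≤ K * ‖s‖ ^ (N + 1) / N ! := hray
    _ = K / N ! * ‖|s| ^ (N + 1)‖ := by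
        rw [Real.norm_eq_abs, Real.norm_eq_abs, abs_pow, abs_abs]
        ring

/-- (A1, any order `N`, same statement with `‖q.1‖`) — norm form of `isBigO_sub_taylorSum_fst`. [cite: HormanderALPDO1, §1.1 Taylor's formula (1.1.7)–(1.1.7)′ and (1.1.8), pp. 12–13] -/
theorem isBigO_sub_taylorSum_fst_norm (F : ℝ × Y → E) (hF : ContDiff ℝ ∞ F) (y₀ : Y) (N : ℕ) :
    (fun q : ℝ × Y => F q - ∑ j ∈ Finset.range (N + 1),
        (q.1 ^ j / (j ! : ℝ)) • iteratedDeriv j (fun s => F (s, q.2)) 0)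
      =O[𝓝 ((0 : ℝ), y₀)] fun q => ‖q.1‖ ^ (N + 1) :=
  (isBigO_sub_taylorSum_fst F hF y₀ N).congr_right fun q => by rw [Real.norm_eq_abs]

end OneVar

section TwoVar

variable {P : Type*} [NormedAddCommGroup P] [NormedSpace ℝ P]
  {E : Type*} [NormedAddCommGroup E] [NormedSpace ℝ E]

/-! ## §3 Two variables with parameters -/

/-- The `v`-slice jets of `G : ℝ × ℝ × P → E`, `(u, z) ↦ ∂ᵥʲ G(u, 0, z)`, are jointly smooth on `ℝ × P`. [cite: HormanderALPDO1, §1.1 Thm. 1.1.6 and the paragraph after (1.1.8), pp. 11–13] -/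
theorem contDiff_iteratedDeriv_slice_snd₃ {G : ℝ × ℝ × P → E} (hG : ContDiff ℝ ∞ G) (j : ℕ) :
    ContDiff ℝ ∞ (fun y : ℝ × P => iteratedDeriv j (fun v => G (y.1, v, y.2)) 0) := by
  -- `G' (v, (u, z)) := G (u, v, z)` is smooth on `ℝ × (ℝ × P)`
  have hG' : ContDiff ℝ ∞ (fun p : ℝ × (ℝ × P) => G (p.2.1, p.1, p.2.2)) :=
    hG.comp ((contDiff_fst.comp contDiff_snd).prodMk
      (contDiff_fst.prodMk (contDiff_snd.comp contDiff_snd)))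
  exact contDiff_iteratedDeriv_slice_fst_zero hG' j

/-- Step 1 of (A3): Taylor in the MIDDLE variable `v` with parameter `(u, z)`:
`G(u, v, z) − Σ_{j ≤ N} (vʲ / j!) • ∂ᵥʲ G(u, 0, z) = O(|v|^{N+1})` as `(u, v, z) → (0, 0, z₀)`. [cite: HormanderALPDO1, §1.1 Taylor's formula (1.1.7)–(1.1.7)′ and (1.1.8), pp. 12–13] -/
theorem isBigO_sub_taylorSum_snd₃ (G : ℝ × ℝ × P → E) (hG : ContDiff ℝ ∞ G) (z₀ : P) (N : ℕ) :
    (fun q : ℝ × ℝ × P => G q - ∑ j ∈ Finset.range (N + 1),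
        (q.2.1 ^ j / (j ! : ℝ)) • iteratedDeriv j (fun v => G (q.1, v, q.2.2)) 0)
      =O[𝓝 ((0, 0, z₀) : ℝ × ℝ × P)] fun q => |q.2.1| ^ (N + 1) := by
  have hG' : ContDiff ℝ ∞ (fun p : ℝ × (ℝ × P) => G (p.2.1, p.1, p.2.2)) :=
    hG.comp ((contDiff_fst.comp contDiff_snd).prodMk
      (contDiff_fst.prodMk (contDiff_snd.comp contDiff_snd)))
  have h1 := isBigO_sub_taylorSum_fst (fun p : ℝ × (ℝ × P) => G (p.2.1, p.1, p.2.2)) hG' ((0 : ℝ), z₀) N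
  -- transport along the shuffle `(u, v, z) ↦ (v, (u, z))`
  have hφ : Tendsto (fun q : ℝ × ℝ × P => (q.2.1, (q.1, q.2.2))) (𝓝 ((0, 0, z₀) : ℝ × ℝ × P))
      (𝓝 (((0 : ℝ), ((0 : ℝ), z₀)) : ℝ × (ℝ × P))) := by
    have hc : Continuous (fun q : ℝ × ℝ × P => (q.2.1, (q.1, q.2.2))) := by fun_prop
    simpa using hc.tendsto ((0, 0, z₀) : ℝ × ℝ × P)
  have h2 := h1.comp_tendsto hφ
  refine h2.congr_left ?_
  intro q
  simp only [Function.comp_apply]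

/-- Step 2 of (A3): for each `j`, Taylor of the coefficient `(u, z) ↦ ∂ᵥʲ G(u, 0, z)` in `u` with parameter `z`, transported to
`ℝ × ℝ × P` and weighted by the bounded factor `vʲ / j!`:  `O(‖(u, v)‖^{N+1})`. [cite: HormanderALPDO1, §1.1 Taylor's formula (1.1.7)–(1.1.7)′ and (1.1.8), pp. 12–13] -/
theorem isBigO_weight_smul_sub_taylorSum_coeff₃ (G : ℝ × ℝ × P → E) (hG : ContDiff ℝ ∞ G) (z₀ : P) (N j : ℕ) :
    (fun q : ℝ × ℝ × P => (q.2.1 ^ j / (j ! : ℝ)) •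
        (iteratedDeriv j (fun v => G (q.1, v, q.2.2)) 0 - ∑ i ∈ Finset.range (N + 1),
          (q.1 ^ i / (i ! : ℝ)) • iteratedDeriv i (fun u => iteratedDeriv j (fun v => G (u, v, q.2.2)) 0) 0))
      =O[𝓝 ((0, 0, z₀) : ℝ × ℝ × P)] fun q => ‖(q.1, q.2.1)‖ ^ (N + 1) := by
  -- the coefficient function `g (u, z) := ∂ᵥʲ G(u, 0, z)` is smooth on `ℝ × P`
  have hg := contDiff_iteratedDeriv_slice_snd₃ hG j
  have h1 := isBigO_sub_taylorSum_fst_norm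
    (fun y : ℝ × P => iteratedDeriv j (fun v => G (y.1, v, y.2)) 0) hg z₀ N
  have hψ : Tendsto (fun q : ℝ × ℝ × P => (q.1, q.2.2)) (𝓝 ((0, 0, z₀) : ℝ × ℝ × P))
      (𝓝 (((0 : ℝ), z₀) : ℝ × P)) := by
    have hc : Continuous (fun q : ℝ × ℝ × P => (q.1, q.2.2)) := by fun_prop
    simpa using hc.tendsto ((0, 0, z₀) : ℝ × ℝ × P)
  have h2 : (fun q : ℝ × ℝ × P => iteratedDeriv j (fun v => G (q.1, v, q.2.2)) 0 -
      ∑ i ∈ Finset.range (N + 1), (q.1 ^ i / (i ! : ℝ)) •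
        iteratedDeriv i (fun u => iteratedDeriv j (fun v => G (u, v, q.2.2)) 0) 0)
      =O[𝓝 ((0, 0, z₀) : ℝ × ℝ × P)] fun q => ‖q.1‖ ^ (N + 1) :=
    (h1.comp_tendsto hψ).congr_left fun q => by simp only [Function.comp_apply]
  -- `‖u‖ ≤ ‖(u, v)‖`
  have h3 : (fun q : ℝ × ℝ × P => ‖q.1‖ ^ (N + 1)) =O[𝓝 ((0, 0, z₀) : ℝ × ℝ × P)]
      fun q => ‖(q.1, q.2.1)‖ ^ (N + 1) := by
    refine IsBigO.of_bound 1 (Filter.Eventually.of_forall fun q => ?_)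
    rw [one_mul, Real.norm_of_nonneg (pow_nonneg (norm_nonneg _) _),
      Real.norm_of_nonneg (pow_nonneg (norm_nonneg _) _)]
    exact pow_le_pow_left₀ (norm_nonneg _) (norm_fst_le (q.1, q.2.1)) _
  -- the weight `vʲ / j!` is bounded near the base point
  have h4 : (fun q : ℝ × ℝ × P => q.2.1 ^ j / (j ! : ℝ)) =O[𝓝 ((0, 0, z₀) : ℝ × ℝ × P)]
      fun _ => (1 : ℝ) := by
    have hc : Continuous (fun q : ℝ × ℝ × P => q.2.1 ^ j / (j ! : ℝ)) := by fun_prop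
    exact (hc.tendsto ((0, 0, z₀) : ℝ × ℝ × P)).isBigO_one ℝ
  have h5 := h4.smul (h2.trans h3)
  refine h5.congr_right fun q => ?_
  simp only [smul_eq_mul, one_mul]

/-- (A3) **Parametric Taylor remainder in two variables, value-flat form, NESTED-JET coefficients.**  For
`G : ℝ × ℝ × P → E` smooth, `z₀ : P` and `N : ℕ`:
`G(u, v, z) − Σ_{i ≤ N} Σ_{j ≤ N} (uⁱ vʲ / (i! j!)) • ∂ᵤⁱ ∂ᵥʲ G(0, 0, z) = O(‖(u, v)‖^{N+1})` as `(u, v, z) → (0, 0, z₀)`, the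
coefficients being the nested one-variable jets `iteratedDeriv i (fun u ↦ iteratedDeriv j (fun v ↦ G (u, v, z)) 0) 0` (square
truncation `i, j ≤ N`). [cite: HormanderALPDO1, §1.1 Taylor's formula (1.1.7)–(1.1.7)′ and (1.1.8), pp. 12–13] -/
theorem isBigO_sub_taylorSum₂ (G : ℝ × ℝ × P → E) (hG : ContDiff ℝ ∞ G) (z₀ : P) (N : ℕ) :
    (fun q : ℝ × ℝ × P => G q - ∑ i ∈ Finset.range (N + 1), ∑ j ∈ Finset.range (N + 1),
        (q.1 ^ i * q.2.1 ^ j / ((i ! : ℝ) * j !)) •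
          iteratedDeriv i (fun u => iteratedDeriv j (fun v => G (u, v, q.2.2)) 0) 0)
      =O[𝓝 ((0, 0, z₀) : ℝ × ℝ × P)] fun q => ‖(q.1, q.2.1)‖ ^ (N + 1) := by
  -- step 1 in `v`, with `|v| ≤ ‖(u, v)‖`
  have h1 : (fun q : ℝ × ℝ × P => G q - ∑ j ∈ Finset.range (N + 1),
      (q.2.1 ^ j / (j ! : ℝ)) • iteratedDeriv j (fun v => G (q.1, v, q.2.2)) 0)
      =O[𝓝 ((0, 0, z₀) : ℝ × ℝ × P)] fun q => ‖(q.1, q.2.1)‖ ^ (N + 1) := by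
    refine (isBigO_sub_taylorSum_snd₃ G hG z₀ N).trans (IsBigO.of_bound 1 (Filter.Eventually.of_forall fun q => ?_))
    rw [one_mul, Real.norm_of_nonneg (pow_nonneg (abs_nonneg _) _),
      Real.norm_of_nonneg (pow_nonneg (norm_nonneg _) _), ← Real.norm_eq_abs]
    exact pow_le_pow_left₀ (norm_nonneg _) (norm_snd_le (q.1, q.2.1)) _
  -- step 2 in `u`, summed over `j ≤ N`
  have h2 := IsBigO.sum (s := Finset.range (N + 1))
    fun j _ => isBigO_weight_smul_sub_taylorSum_coeff₃ G hG z₀ N j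
  refine (h1.add h2).congr_left fun q => ?_
  -- algebra: `(G − Σⱼ wⱼ • gⱼ) + Σⱼ wⱼ • (gⱼ − Σᵢ aᵢ • cᵢⱼ) = G − Σᵢ Σⱼ (aᵢ wⱼ) • cᵢⱼ`
  simp only [smul_sub, Finset.sum_sub_distrib, Finset.smul_sum, smul_smul]
  rw [Finset.sum_comm]
  have hcoef : ∀ i j : ℕ, q.2.1 ^ j / (j ! : ℝ) * (q.1 ^ i / (i ! : ℝ)) = q.1 ^ i * q.2.1 ^ j / ((i ! : ℝ) * j !) := by
    intro i j
    field_simp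
  simp only [hcoef]
  abel

/-! ## §4 Bookkeeping for consumers: monomials and truncations -/

omit [NormedSpace ℝ P] in
/-- Near the base point higher powers of `‖(u, v)‖` are smaller: `‖(u,v)‖^m = O(‖(u,v)‖^n)` for `n ≤ m`. [cite: HormanderALPDO1, §1.1 Taylor's formula (1.1.7)–(1.1.7)′ and (1.1.8), pp. 12–13] -/
theorem isBigO_norm_pow_of_le (z₀ : P) {n m : ℕ} (h : n ≤ m) :
    (fun q : ℝ × ℝ × P => ‖(q.1, q.2.1)‖ ^ m) =O[𝓝 ((0, 0, z₀) : ℝ × ℝ × P)] fun q => ‖(q.1, q.2.1)‖ ^ n := by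
  -- on the ball of radius `1` about the base point, `‖(u, v)‖ ≤ 1`
  refine IsBigO.of_bound 1 ?_
  filter_upwards [Metric.ball_mem_nhds ((0, 0, z₀) : ℝ × ℝ × P) one_pos] with q hq
  rw [one_mul, Real.norm_of_nonneg (pow_nonneg (norm_nonneg _) _),
    Real.norm_of_nonneg (pow_nonneg (norm_nonneg _) _)]
  have hq1 : ‖(q.1, q.2.1)‖ ≤ 1 := by
    rw [Metric.mem_ball, Prod.dist_eq, Prod.dist_eq] at hq
    rw [Prod.norm_def]
    refine max_le ?_ ?_
    · have := lt_of_le_of_lt (le_max_left _ _) hq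
      rw [dist_zero_right] at this
      exact this.le
    · have := lt_of_le_of_lt (le_max_left _ _) (lt_of_le_of_lt (le_max_right _ _) hq)
      rw [dist_zero_right] at this
      exact this.le
  exact pow_le_pow_of_le_one (norm_nonneg _) hq1 h

omit [NormedSpace ℝ P] in
/-- A monomial `uⁱ vʲ / (i! j!)` times a coefficient continuous in the parameter is `O(‖(u, v)‖^{i+j})` at the base point. [cite: HormanderALPDO1, §1.1 Taylor's formula (1.1.7)–(1.1.7)′ and (1.1.8), pp. 12–13] -/
theorem isBigO_monomial_smul {c : P → E} (hc : Continuous c) (z₀ : P) (i j : ℕ) :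
    (fun q : ℝ × ℝ × P => (q.1 ^ i * q.2.1 ^ j / ((i ! : ℝ) * j !)) • c q.2.2)
      =O[𝓝 ((0, 0, z₀) : ℝ × ℝ × P)] fun q => ‖(q.1, q.2.1)‖ ^ (i + j) := by
  have h1 : (fun q : ℝ × ℝ × P => q.1 ^ i * q.2.1 ^ j / ((i ! : ℝ) * j !))
      =O[𝓝 ((0, 0, z₀) : ℝ × ℝ × P)] fun q => ‖(q.1, q.2.1)‖ ^ (i + j) := by
    refine IsBigO.of_bound (1 / ((i ! : ℝ) * j !)) (Filter.Eventually.of_forall fun q => ?_)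
    have hu : |q.1| ≤ ‖(q.1, q.2.1)‖ := by
      have h := norm_fst_le (q.1, q.2.1)
      rwa [Real.norm_eq_abs] at h
    have hv : |q.2.1| ≤ ‖(q.1, q.2.1)‖ := by
      have h := norm_snd_le (q.1, q.2.1)
      rwa [Real.norm_eq_abs] at h
    have hfac : (0 : ℝ) < (i ! : ℝ) * j ! := by positivity
    rw [Real.norm_of_nonneg (pow_nonneg (norm_nonneg _) _), Real.norm_eq_abs, abs_div, abs_mul, abs_pow, abs_pow,
      abs_of_pos hfac, pow_add, one_div_mul_eq_div]
    exact div_le_div_of_nonneg_right (mul_le_mul (pow_le_pow_left₀ (abs_nonneg _) hu i)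
      (pow_le_pow_left₀ (abs_nonneg _) hv j) (pow_nonneg (abs_nonneg _) _) (pow_nonneg (norm_nonneg _) _)) hfac.le
  have h2 : (fun q : ℝ × ℝ × P => c q.2.2) =O[𝓝 ((0, 0, z₀) : ℝ × ℝ × P)] fun _ => (1 : ℝ) := by
    have hcc : Continuous (fun q : ℝ × ℝ × P => c q.2.2) := by fun_prop
    exact (hcc.tendsto ((0, 0, z₀) : ℝ × ℝ × P)).isBigO_one ℝ
  have h3 := h1.smul h2
  refine h3.congr_right fun q => ?_
  simp only [smul_eq_mul, mul_one]

omit [NormedSpace ℝ P] in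
/-- A monomial of total degree `i + j ≥ n` with a continuous coefficient is `O(‖(u, v)‖^n)` at the base point. [cite: HormanderALPDO1, §1.1 Taylor's formula (1.1.7)–(1.1.7)′ and (1.1.8), pp. 12–13] -/
theorem isBigO_monomial_smul_of_le {c : P → E} (hc : Continuous c) (z₀ : P) {i j n : ℕ} (h : n ≤ i + j) :
    (fun q : ℝ × ℝ × P => (q.1 ^ i * q.2.1 ^ j / ((i ! : ℝ) * j !)) • c q.2.2)
      =O[𝓝 ((0, 0, z₀) : ℝ × ℝ × P)] fun q => ‖(q.1, q.2.1)‖ ^ n :=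
  (isBigO_monomial_smul hc z₀ i j).trans (isBigO_norm_pow_of_le z₀ h)

/-- (A3′) **Triangular truncation.**  The same value-flat Taylor remainder with the total-degree truncation `i + j ≤ N`:
`G(u, v, z) − Σ_{i + j ≤ N} (uⁱ vʲ / (i! j!)) • ∂ᵤⁱ ∂ᵥʲ G(0, 0, z) = O(‖(u, v)‖^{N+1})` (the square truncation of (A3) minus the monomials
of total degree `> N`, each `O(‖(u, v)‖^{N+1})` by §4). [cite: HormanderALPDO1, §1.1 Taylor's formula (1.1.7)–(1.1.7)′ and (1.1.8), pp. 12–13] -/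
theorem isBigO_sub_taylorSum₂_triangular (G : ℝ × ℝ × P → E) (hG : ContDiff ℝ ∞ G) (z₀ : P) (N : ℕ) :
    (fun q : ℝ × ℝ × P => G q - ∑ i ∈ Finset.range (N + 1), ∑ j ∈ Finset.range (N + 1 - i),
        (q.1 ^ i * q.2.1 ^ j / ((i ! : ℝ) * j !)) •
          iteratedDeriv i (fun u => iteratedDeriv j (fun v => G (u, v, q.2.2)) 0) 0)
      =O[𝓝 ((0, 0, z₀) : ℝ × ℝ × P)] fun q => ‖(q.1, q.2.1)‖ ^ (N + 1) := by
  -- the coefficients are continuous in `z`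
  have hcont : ∀ i j : ℕ, Continuous (fun z : P => iteratedDeriv i (fun u => iteratedDeriv j (fun v => G (u, v, z)) 0) 0) := by
    intro i j
    have h := contDiff_iteratedDeriv_slice_fst_zero (contDiff_iteratedDeriv_slice_snd₃ hG j) i
    exact h.continuous
  -- the square truncation splits as triangular part + high-degree part
  have hsplit : ∀ q : ℝ × ℝ × P, ∑ i ∈ Finset.range (N + 1), ∑ j ∈ Finset.range (N + 1),
      (q.1 ^ i * q.2.1 ^ j / ((i ! : ℝ) * j !)) • iteratedDeriv i (fun u => iteratedDeriv j (fun v => G (u, v, q.2.2)) 0) 0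
      = (∑ i ∈ Finset.range (N + 1), ∑ j ∈ Finset.range (N + 1 - i),
          (q.1 ^ i * q.2.1 ^ j / ((i ! : ℝ) * j !)) • iteratedDeriv i (fun u => iteratedDeriv j (fun v => G (u, v, q.2.2)) 0) 0) +
        ∑ i ∈ Finset.range (N + 1), ∑ j ∈ Finset.Ico (N + 1 - i) (N + 1),
          (q.1 ^ i * q.2.1 ^ j / ((i ! : ℝ) * j !)) • iteratedDeriv i (fun u => iteratedDeriv j (fun v => G (u, v, q.2.2)) 0) 0 := by
    intro q
    rw [← Finset.sum_add_distrib]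
    refine Finset.sum_congr rfl fun i hi => ?_
    have hiN : N + 1 - i ≤ N + 1 := Nat.sub_le _ _
    rw [Finset.range_eq_Ico, ← Finset.Ico_union_Ico_eq_Ico (Nat.zero_le _) hiN,
      Finset.sum_union (Finset.Ico_disjoint_Ico_consecutive 0 (N + 1 - i) (N + 1)), ← Finset.range_eq_Ico]
  have hhigh : (fun q : ℝ × ℝ × P => ∑ i ∈ Finset.range (N + 1), ∑ j ∈ Finset.Ico (N + 1 - i) (N + 1),
      (q.1 ^ i * q.2.1 ^ j / ((i ! : ℝ) * j !)) • iteratedDeriv i (fun u => iteratedDeriv j (fun v => G (u, v, q.2.2)) 0) 0)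
      =O[𝓝 ((0, 0, z₀) : ℝ × ℝ × P)] fun q => ‖(q.1, q.2.1)‖ ^ (N + 1) := by
    refine IsBigO.sum fun i hi => IsBigO.sum fun j hj => ?_
    refine isBigO_monomial_smul_of_le (hcont i j) z₀ ?_
    have := (Finset.mem_Ico.mp hj).1
    omega
  have h := (isBigO_sub_taylorSum₂ G hG z₀ N).add hhigh
  refine h.congr_left fun q => ?_
  rw [hsplit q]
  abel

end TwoVar

end Literature.Analysis.Calculus
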